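import Summits.AnomalousDissipation.AnomalousDissipation.Theses.MomentParity
import Summits.AnomalousDissipation.AnomalousDissipation.Theorems.MomentParityResolvedDissipationStubStretchingBound
import Summits.AnomalousDissipation.AnomalousDissipation.Theorems.MomentParityResolvedDissipationStubZeroMeanGalerkinFlow
import Literature.Analysis.FluidPDE.GalerkinFlow
import Literature.Analysis.FluidPDE.NSGalerkinEnstrophy2D
import Literature.Analysis.FunctionSpaces.TorusTruncationH1

/-!
# The trajectory-UI stub with a level-dependent window is a THEOREM, uniformly in the Galerkin order
# (crux `MomentParity.ResolvedDissipation`, stmt-AnomalousDissipation-14284, line `enstrophy-ui-transfer`)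

Supports stmt-AnomalousDissipation-14284 (lead c5). Nothing here closes the item.

The registered hard stub S1 `stub_trajectoryUI` (TUI) asks for ONE window `T = T(f, ν, R)` serving every
data-enstrophy level `G`: `∃ T ∀ G ∀ ε ∃ M ∀ N …`. This file proves the same statement with the window
allowed to depend on the level, `∀ G ∃ T ∃ M ∀ N …` — in fact with the integrand identically zero —
by **Leray's local propagation of enstrophy for the Galerkin systems, uniformly in the order `N`**:

* `galerkin_enstrophy_deriv_le` — along every coefficient orbit of the order-`N` Galerkin system with a
  smooth mean-zero force `f` and mean-zero data, the enstrophy `Z(t) = ‖∇u(t)‖₂²` satisfies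
  `Z' ≤ (27 C₀⁴/(16 ν³)) Z³ + ‖f‖₂²/ν` with the SHARP AGMON constant `C₀` of the tree
  (`StretchingBound.norm_realTrigPoly_le_sharpAgmon`), independent of `N`: the enstrophy identity
  `Z' = 2(∫⟪Δu,(u·∇)u⟫ − ν‖Δu‖₂² − ∫⟪f, Δu⟫)` (`hasDerivWithinAt_enstrophy`), the stretching bound
  `|∫⟪Δu,(u·∇)u⟫| ≤ ‖Δu‖₂ ‖u‖_∞ ‖∇u‖₂ ≤ C₀ ‖∇u‖₂^{3/2} ‖Δu‖₂^{3/2}` and Young;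
* `galerkin_enstrophy_local_bound` — hence from data of enstrophy `≤ G` the enstrophy stays `≤ 2G + 1`
  on the window `[0, T(G)]`, `T(G) = (G+1)/((27 C₀⁴/(16ν³))(2G+2)³ + ‖f‖₂²/ν + 1)`, for EVERY order `N`
  (barrier argument, `image_le_of_deriv_right_lt_deriv_boundary`);
* `trajectoryUI_levelDependentWindow` — the TUI integrand `Z·1{Z > 2G+1}` vanishes on `(0, T(G))`, so the
  registered signature of S1 with `∃ T` moved after `∀ G` holds (with `∫ = 0 ≤ ε`).

Together with `TrajectoryUIAnatomy.not_trajectoryUI_without_enstrophyBound` (the data-enstrophy bound is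
necessary) this pins the conjecture-grade content of S1 to the uniformity of the window in `G`.

References: Leray 1934 §20; Constantin–Foias 1988 Ch. 9–10; Foias–Manley–Rosa–Temam 2001 Ch. II App. A
(A.26)–(A.29), (A.55); Robinson–Rodrigo–Sadowski 2016 Thm. 6.8 / Lemma 6.12; Tao arXiv:0710.1604 §5.
-/

noncomputable section

-- `Summit.<Summit>.<Problem>`: single-conjunct summit, the duplicate namespace segment is mandated.
set_option linter.dupNamespace false

namespace Summit.AnomalousDissipation.AnomalousDissipation.Theorems.MomentParityResolvedDissipation.TrajectoryUILocalWindow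

open MeasureTheory Filter Topology Set UnitAddTorus
open scoped ENNReal InnerProductSpace RealInnerProductSpace BigOperators
open Literature.Analysis.FunctionSpaces Literature.Analysis.FunctionSpaces.Torus
open Literature.Analysis.FluidPDE Literature.Analysis.FluidPDE.Torus
open Summit.AnomalousDissipation.AnomalousDissipation.Theorems.CubicParityLoud.Negative (T3 R3)
open Summit.AnomalousDissipation.AnomalousDissipation.Theorems.MomentParityResolvedDissipation.StretchingBound
  (norm_realTrigPoly_le_sharpAgmon abs_integral_inner_le_sqrt_mul_sqrt)
open Summit.AnomalousDissipation.AnomalousDissipation.Theorems.UniformResolution.Negative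
  (integral_norm_sq_convect_self_le integral_sum_norm_sq_partialDeriv_realTrigPoly
    integral_norm_sq_laplacian_realTrigPoly)

/-! ## Algebra: the two Young absorptions -/

/-- **Young absorption of the stretching term**: for `ν > 0`, `C₀, e, l ≥ 0`,
`C₀ e³ l³ − (ν/2) l⁴ ≤ (27 C₀⁴/(32 ν³)) e¹²` — the polynomial identity
`27C₀⁴e¹² − 32ν³C₀e³l³ + 16ν⁴l⁴ = (2νl − 3C₀e³)²((2νl + C₀e³)² + 2C₀²e⁶)`. [folklore] -/
theorem stretching_young {ν : ℝ} (C₀ e l : ℝ) (hν : 0 < ν) :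
    C₀ * e ^ 3 * l ^ 3 - ν / 2 * l ^ 4 ≤ 27 * C₀ ^ 4 / (32 * ν ^ 3) * e ^ 12 := by
  have hν3 : 0 < 32 * ν ^ 3 := by positivity
  have key : 0 ≤ (2 * ν * l - 3 * C₀ * e ^ 3) ^ 2 * ((2 * ν * l + C₀ * e ^ 3) ^ 2 + 2 * C₀ ^ 2 * e ^ 6) := by
    positivity
  have hid : 27 * C₀ ^ 4 * e ^ 12 - 32 * ν ^ 3 * (C₀ * e ^ 3 * l ^ 3) + 16 * ν ^ 4 * l ^ 4 =
      (2 * ν * l - 3 * C₀ * e ^ 3) ^ 2 * ((2 * ν * l + C₀ * e ^ 3) ^ 2 + 2 * C₀ ^ 2 * e ^ 6) := by ring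
  have hdiff : 27 * C₀ ^ 4 / (32 * ν ^ 3) * e ^ 12 - (C₀ * e ^ 3 * l ^ 3 - ν / 2 * l ^ 4) =
      (2 * ν * l - 3 * C₀ * e ^ 3) ^ 2 * ((2 * ν * l + C₀ * e ^ 3) ^ 2 + 2 * C₀ ^ 2 * e ^ 6) /
        (32 * ν ^ 3) := by
    rw [← hid]
    field_simp
    ring
  have hnn : 0 ≤ (2 * ν * l - 3 * C₀ * e ^ 3) ^ 2 * ((2 * ν * l + C₀ * e ^ 3) ^ 2 + 2 * C₀ ^ 2 * e ^ 6) /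
      (32 * ν ^ 3) := div_nonneg key hν3.le
  linarith

/-- **Young absorption of the force term**: `F l² − (ν/2) l⁴ ≤ F²/(2ν)` for `ν > 0`. [folklore] -/
theorem force_young {ν F l : ℝ} (hν : 0 < ν) : F * l ^ 2 - ν / 2 * l ^ 4 ≤ F ^ 2 / (2 * ν) := by
  have hid : F * l ^ 2 - ν / 2 * l ^ 4 - F ^ 2 / (2 * ν) = -((ν * l ^ 2 - F) ^ 2 / (2 * ν)) := by
    field_simp
    ring
  have hnn : 0 ≤ (ν * l ^ 2 - F) ^ 2 / (2 * ν) := by positivity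
  linarith

/-- Quarter powers: for `Z ≥ 0` and `e = Z^{1/4}`, `Z = e⁴`. [folklore] -/
theorem eq_rpow_quarter_pow_four {Z : ℝ} (hZ : 0 ≤ Z) : Z = (Z ^ (1 / 4 : ℝ)) ^ 4 := by
  rw [← Real.rpow_natCast, ← Real.rpow_mul hZ]; norm_num

/-! ## The enstrophy generator of the Galerkin system, bounded uniformly in the order -/

/-- **The `N`-uniform enstrophy inequality for the Galerkin systems (generator form).** Let `ν > 0`,
`f ∈ L²(T³)`, and let `c` be a real divergence-free coefficient vector on the frequency ball of order `N`
with vanishing mean mode, `u = Σ_{|k|≤N} c_k e^{2πik·x}` its field. Then the right-hand side of the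
enstrophy identity along the Galerkin ODE (`hasDerivWithinAt_enstrophy`) obeys
`2(∫⟪Δu,(u·∇)u⟫ − ν‖Δu‖₂² − ∫⟪P_N f, Δu⟫) ≤ (27C₀⁴/(16ν³)) ‖∇u‖₂⁶ + ‖f‖₂²/ν`,
where `C₀` is any constant in the sharp Agmon inequality `‖u‖_∞ ≤ C₀‖∇u‖₂^{1/2}‖Δu‖₂^{1/2}` for
mean-free trigonometric polynomials (hypothesis `hAg`, discharged by
`StretchingBound.norm_realTrigPoly_le_sharpAgmon`): Cauchy–Schwarz, `∫‖(u·∇)u‖² ≤ ‖u‖_∞²‖∇u‖₂²`,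
Agmon, `∫⟪P_N f, Δu⟫ = ∫⟪f, Δu⟫`, and the two Young absorptions into `ν‖Δu‖₂²`. The bound does not
depend on `N`. [cite: FMRTTurbulence2001, Ch. II App. A (A.26)–(A.29), (A.55)] -/
theorem galerkin_generator_enstrophy_le {ν : ℝ} (hν : 0 < ν) {C₀ : ℝ} (hC₀ : 0 ≤ C₀)
    (hAg : ∀ (S : Finset (Fin 3 → ℤ)) (c : (Fin 3 → ℤ) → EuclideanSpace ℂ (Fin 3)), c 0 = 0 →
      ∀ x : T3, ‖realTrigPoly S c x‖ ≤
        C₀ * (4 * Real.pi ^ 2 * ∑ k ∈ S, freqNormSq k * ‖c k‖ ^ 2) ^ (1 / 4 : ℝ) *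
          (16 * Real.pi ^ 4 * ∑ k ∈ S, freqNormSq k ^ 2 * ‖c k‖ ^ 2) ^ (1 / 4 : ℝ))
    {f : T3 → R3} (hf : MemLp f 2 volume) {N : ℕ}
    {c : ↥(freqBall (d := Fin 3) N) → EuclideanSpace ℂ (Fin 3)} (hc : c ∈ galerkinSubspace (freqBall N))
    (hc0 : coeffExt (freqBall N) c 0 = 0) :
    2 * ((∫ x, ⟪laplacian (realTrigPoly (freqBall N) (coeffExt (freqBall N) c)) x,
          convect (realTrigPoly (freqBall N) (coeffExt (freqBall N) c))
            (realTrigPoly (freqBall N) (coeffExt (freqBall N) c)) x⟫_ℝ) -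
        ν * (eLaplacianNormSq (realTrigPoly (freqBall N) (coeffExt (freqBall N) c))).toReal -
        ∫ x, ⟪realTrigPoly (freqBall N) (coeffExt (freqBall N) (fourierRestrict (freqBall N) f)) x,
          laplacian (realTrigPoly (freqBall N) (coeffExt (freqBall N) c)) x⟫_ℝ) ≤
      27 * C₀ ^ 4 / (16 * ν ^ 3) *
          (4 * Real.pi ^ 2 * ∑ k : ↥(freqBall (d := Fin 3) N), freqNormSq (k : Fin 3 → ℤ) * ‖c k‖ ^ 2) ^ 3 +
        (∫ x, ‖f x‖ ^ 2) / ν := by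
  have hS : ∀ k ∈ freqBall (d := Fin 3) N, -k ∈ freqBall N := neg_mem_freqBall_of_mem
  have hcs : IsConjSymm (coeffExt (freqBall N) c) := hc.1.isConjSymm_coeffExt hS
  set u : T3 → R3 := realTrigPoly (freqBall N) (coeffExt (freqBall N) c) with hudef
  have hu : IsSmooth u := isSmooth_realTrigPoly (freqBall N) _
  -- the two spectral quantities
  set Z : ℝ := 4 * Real.pi ^ 2 * ∑ k ∈ freqBall N, freqNormSq k * ‖coeffExt (freqBall N) c k‖ ^ 2 with hZdef
  set P : ℝ := 16 * Real.pi ^ 4 * ∑ k ∈ freqBall N, freqNormSq k ^ 2 * ‖coeffExt (freqBall N) c k‖ ^ 2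
    with hPdef
  have hZ0 : 0 ≤ Z :=
    mul_nonneg (by positivity) (Finset.sum_nonneg fun k _ => mul_nonneg (freqNormSq_nonneg k) (sq_nonneg _))
  have hP0 : 0 ≤ P :=
    mul_nonneg (by positivity) (Finset.sum_nonneg fun k _ => mul_nonneg (sq_nonneg _) (sq_nonneg _))
  have hZsub : 4 * Real.pi ^ 2 * ∑ k : ↥(freqBall (d := Fin 3) N), freqNormSq (k : Fin 3 → ℤ) * ‖c k‖ ^ 2 = Z := by
    rw [hZdef, sum_coeffExt (fun k v => freqNormSq k * ‖v‖ ^ 2) c]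
  have hPeq : (eLaplacianNormSq u).toReal = P := toReal_eLaplacianNormSq_realTrigPoly hS hcs
  have hlapP : ∫ x, ‖laplacian u x‖ ^ 2 = P := integral_norm_sq_laplacian_realTrigPoly hS hcs
  have hgradZ : ∫ x, ∑ j, ‖partialDeriv j u x‖ ^ 2 = Z :=
    integral_sum_norm_sq_partialDeriv_realTrigPoly hS hcs
  -- quarter powers
  set e : ℝ := Z ^ (1 / 4 : ℝ) with he
  set l : ℝ := P ^ (1 / 4 : ℝ) with hl
  have he0 : 0 ≤ e := Real.rpow_nonneg hZ0 _
  have hl0 : 0 ≤ l := Real.rpow_nonneg hP0 _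
  have he4 : Z = e ^ 4 := eq_rpow_quarter_pow_four hZ0
  have hl4 : P = l ^ 4 := eq_rpow_quarter_pow_four hP0
  have hsqrtP : Real.sqrt P = l ^ 2 := by
    rw [hl4, show l ^ 4 = (l ^ 2) ^ 2 by ring, Real.sqrt_sq (by positivity)]
  -- Agmon: `‖u x‖ ≤ C₀ e l`
  have hsup : ∀ x, ‖u x‖ ≤ C₀ * e * l := fun x => hAg (freqBall N) (coeffExt (freqBall N) c) hc0 x
  -- the stretching term `|∫⟪Δu,(u·∇)u⟫| ≤ C₀ e³ l³`
  have hconv : ∫ x, ‖convect u u x‖ ^ 2 ≤ (C₀ * e * l) ^ 2 * Z := by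
    have h := integral_norm_sq_convect_self_le hu hsup
    rwa [hgradZ] at h
  have hX : |∫ x, ⟪laplacian u x, convect u u x⟫_ℝ| ≤ C₀ * e ^ 3 * l ^ 3 := by
    calc |∫ x, ⟪laplacian u x, convect u u x⟫_ℝ|
        ≤ Real.sqrt (∫ x, ‖laplacian u x‖ ^ 2) * Real.sqrt (∫ x, ‖convect u u x‖ ^ 2) :=
          abs_integral_inner_le_sqrt_mul_sqrt (hu.laplacian.memLp 2) ((hu.convect hu).memLp 2)
      _ ≤ Real.sqrt P * Real.sqrt ((C₀ * e * l) ^ 2 * Z) := by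
          rw [hlapP]; gcongr
      _ = C₀ * e ^ 3 * l ^ 3 := by
          rw [hsqrtP, he4, show (C₀ * e * l) ^ 2 * e ^ 4 = (C₀ * e ^ 3 * l) ^ 2 by ring,
            Real.sqrt_sq (by positivity)]
          ring
  -- the force term `|∫⟪P_N f, Δu⟫| ≤ ‖f‖₂ l²`
  have hband : ∀ k ∉ freqBall N, mFourierCoeff (EuclideanSpace.complexify ∘ laplacian u) k = 0 := by
    intro k hk
    have hfun : laplacian u = realTrigPoly (freqBall N)
        (fun k => -(((4 * Real.pi ^ 2 * freqNormSq k : ℝ) : ℂ) • coeffExt (freqBall N) c k)) :=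
      funext (laplacian_realTrigPoly (freqBall N) _)
    rw [hfun]
    exact mFourierCoeff_realTrigPoly_eq_zero hS (isConjSymm_laplacianCoeff hcs) hk
  set F2 : ℝ := ∫ x, ‖f x‖ ^ 2 with hF2
  have hF20 : 0 ≤ F2 := integral_nonneg fun _ => sq_nonneg _
  have hY : |∫ x, ⟪realTrigPoly (freqBall N) (coeffExt (freqBall N) (fourierRestrict (freqBall N) f)) x,
      laplacian u x⟫_ℝ| ≤ Real.sqrt F2 * l ^ 2 := by
    rw [realTrigPoly_coeffExt_fourierRestrict N f,
      integral_inner_fourierTruncate_eq hf (hu.laplacian.memLp 2) hband, ← hsqrtP, ← hlapP]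
    exact abs_integral_inner_le_sqrt_mul_sqrt hf (hu.laplacian.memLp 2)
  -- assemble
  have hXle := (le_abs_self _).trans hX
  have hYle := (neg_le_abs _).trans hY
  have h1 := stretching_young C₀ e l hν
  have h2 := force_young (F := Real.sqrt F2) (l := l) hν
  rw [Real.sq_sqrt hF20] at h2
  rw [hZsub, hPeq, he4, hl4]
  have he12 : (e ^ 4) ^ 3 = e ^ 12 := by ring
  rw [he12]
  have h1' : 2 * (27 * C₀ ^ 4 / (32 * ν ^ 3) * e ^ 12) = 27 * C₀ ^ 4 / (16 * ν ^ 3) * e ^ 12 := by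
    field_simp; ring
  have h2' : 2 * (F2 / (2 * ν)) = F2 / ν := by field_simp
  linarith [hXle, hYle, h1, h2, h1', h2']

/-! ## Leray's local propagation of enstrophy for the Galerkin systems, uniformly in the order -/

/-- **`N`-uniform local enstrophy bound for the Galerkin systems.** For `ν > 0`, a smooth mean-zero force
`f` and a level `G ≥ 0` there is a window `T = T(G, ν, f) > 0` such that for EVERY order `N` and every
mean-zero Galerkin mode `a` of order `N` with `‖∇a‖² ≤ G`, the enstrophy of the Galerkin orbit stays
below `2G + 1` on `[0, T]`: `‖∇S^N_t a‖² ≤ 2G + 1` for `t ∈ [0, T]`. Explicitly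
`T = (G+1)/((27C₀⁴/(16ν³))(2G+2)³ + ‖f‖₂²/ν + 1)` with the sharp Agmon constant `C₀`.
Proof: the enstrophy `Z(t)` of the coefficient orbit is continuous with right derivative
`2(∫⟪Δu,(u·∇)u⟫ − ν‖Δu‖₂² − ∫⟪P_N f, Δu⟫) ≤ A Z³ + B` (`hasDerivWithinAt_enstrophy`,
`galerkin_generator_enstrophy_le`; the orbit stays mean-zero, `ZeroMeanFlow.stub_zeroMean_galerkinFlow`),
and the line `G + D t`, `D = A(2G+2)³ + B + 1`, is a strict upper barrier on `[0, T]`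
(`image_le_of_deriv_right_lt_deriv_boundary`). [cite: FMRTTurbulence2001, Ch. II App. A (A.55)–(A.58)] -/
theorem galerkin_enstrophy_local_bound {ν : ℝ} (hν : 0 < ν) {f : T3 → R3} (hf : IsSmooth f)
    (hf0 : HasZeroMean f) {G : ℝ} (hG : 0 ≤ G) :
    ∃ T : ℝ, 0 < T ∧ ∀ (N : ℕ) (a : T3 → R3), IsGalerkinMode N a → HasZeroMean a →
      eGradNormSq a ≤ ENNReal.ofReal G →
      ∀ t ∈ Icc 0 T, eGradNormSq (galerkinFlow ν f N t a) ≤ ENNReal.ofReal (2 * G + 1) := by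
  obtain ⟨C₀, hC₀, hAg⟩ := norm_realTrigPoly_le_sharpAgmon
  -- constants
  set A : ℝ := 27 * C₀ ^ 4 / (16 * ν ^ 3) with hA
  have hA0 : 0 ≤ A := by positivity
  set B : ℝ := (∫ x, ‖f x‖ ^ 2) / ν with hB
  have hB0 : 0 ≤ B := div_nonneg (integral_nonneg fun _ => sq_nonneg _) hν.le
  set D : ℝ := A * (2 * G + 2) ^ 3 + B + 1 with hD
  have hD0 : 0 < D := by positivity
  set T : ℝ := (G + 1) / D with hT
  have hT0 : 0 < T := by positivity
  have hDT : D * T = G + 1 := by rw [hT]; field_simp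
  refine ⟨T, hT0, fun N a ha ha0 hZa t ht => ?_⟩
  -- the coefficient orbit
  have hS : ∀ k ∈ freqBall (d := Fin 3) N, -k ∈ freqBall N := neg_mem_freqBall_of_mem
  have hfm : MemLp f 2 volume := hf.memLp 2
  have hg : IsRealCoeff (fourierRestrict (freqBall N) f) := isRealCoeff_mFourierCoeff (hfm.integrable one_le_two)
  have hc : fourierRestrict (freqBall N) a ∈ galerkinSubspace (freqBall N) := ha.fourierRestrict_mem
  set β : ℝ → ↥(freqBall (d := Fin 3) N) → EuclideanSpace ℂ (Fin 3) :=
    fun s => galerkinCoeffFlow ν (fourierRestrict (freqBall N) f) s (fourierRestrict (freqBall N) a) with hβ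
  have hsol : IsGalerkinODESolution ν (fourierRestrict (freqBall N) f) (fourierRestrict (freqBall N) a) β :=
    isGalerkinODESolution_galerkinCoeffFlow hν.le hS hg hc
  -- the enstrophy of the orbit and its identification with the field enstrophy
  set Zr : ℝ → ℝ := fun s => 4 * Real.pi ^ 2 *
    ∑ k : ↥(freqBall (d := Fin 3) N), freqNormSq (k : Fin 3 → ℤ) * ‖β s k‖ ^ 2 with hZr
  have hflow : ∀ s, galerkinFlow ν f N s a = realTrigPoly (freqBall N) (coeffExt (freqBall N) (β s)) :=
    fun s => ha.galerkinFlow_eq s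
  have hZr_eq : ∀ s, (eGradNormSq (galerkinFlow ν f N s a)).toReal = Zr s := fun s => by
    rw [hflow s, toReal_eGradNormSq_coeffExt hS (hsol.mem s).1]
  have hZr_of : ∀ s, eGradNormSq (galerkinFlow ν f N s a) = ENNReal.ofReal (Zr s) := fun s => by
    rw [← hZr_eq s, ENNReal.ofReal_toReal]
    rw [hflow s, eGradNormSq_realTrigPoly hS ((hsol.mem s).1.isConjSymm_coeffExt hS)]
    exact ENNReal.ofReal_ne_top
  have hZr0 : ∀ s, 0 ≤ Zr s := fun s =>
    mul_nonneg (by positivity) (Finset.sum_nonneg fun k _ => mul_nonneg (freqNormSq_nonneg _) (sq_nonneg _))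
  -- continuity on `[0, T]`
  have hβc : ContinuousOn β (Icc 0 T) := hsol.continuousOn.mono Icc_subset_Ici_self
  have hcont : ContinuousOn Zr (Icc 0 T) := by
    refine continuousOn_const.mul (continuousOn_finsetSum _ fun k _ => continuousOn_const.mul ?_)
    exact (((continuous_apply k).comp_continuousOn hβc).norm).pow 2
  -- the generator
  set Zr' : ℝ → ℝ := fun s =>
    2 * ((∫ x, ⟪laplacian (realTrigPoly (freqBall N) (coeffExt (freqBall N) (β s))) x,
          convect (realTrigPoly (freqBall N) (coeffExt (freqBall N) (β s)))
            (realTrigPoly (freqBall N) (coeffExt (freqBall N) (β s))) x⟫_ℝ) -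
        ν * (eLaplacianNormSq (realTrigPoly (freqBall N) (coeffExt (freqBall N) (β s)))).toReal -
        ∫ x, ⟪realTrigPoly (freqBall N) (coeffExt (freqBall N) (fourierRestrict (freqBall N) f)) x,
          laplacian (realTrigPoly (freqBall N) (coeffExt (freqBall N) (β s))) x⟫_ℝ) with hZr'
  have hderiv : ∀ s ∈ Ico 0 T, HasDerivWithinAt Zr (Zr' s) (Ici s) s := fun s hs =>
    hasDerivWithinAt_enstrophy ν hS (hsol.hasDerivWithinAt_Ici hs) (hsol.mem s) hg
  -- the mean mode vanishes along the orbit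
  have hmean : ∀ s, 0 ≤ s → coeffExt (freqBall N) (β s) 0 = 0 := by
    intro s hs
    have h0 := mFourierCoeff_complexify_eq_zero_of_hasZeroMean
      (ZeroMeanFlow.stub_zeroMean_galerkinFlow ν hν.le f hf hf0 N a ha ha0 s hs)
    rw [hflow s, mFourierCoeff_realTrigPoly hS ((hsol.mem s).1.isConjSymm_coeffExt hS),
      if_pos (zero_mem_freqBall N)] at h0
    exact h0
  -- the `N`-uniform differential inequality
  have hgen : ∀ s, 0 ≤ s → Zr' s ≤ A * Zr s ^ 3 + B := fun s hs =>
    galerkin_generator_enstrophy_le hν hC₀ hAg hfm (hsol.mem s) (hmean s hs)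
  -- the barrier
  have hBl : ∀ s, HasDerivAt (fun s => G + D * s) D s := fun s => by
    simpa using ((hasDerivAt_id s).const_mul D).const_add G
  have h0 : Zr 0 ≤ G + D * 0 := by
    rw [mul_zero, add_zero, ← hZr_eq 0, galerkinFlow_zero]
    have := ENNReal.toReal_mono ENNReal.ofReal_ne_top hZa
    rwa [ENNReal.toReal_ofReal hG] at this
  have hbound : ∀ s ∈ Ico 0 T, Zr s = G + D * s → Zr' s < D := by
    intro s hs hZs
    have hZle : Zr s ≤ 2 * G + 1 := by
      rw [hZs]
      have : D * s ≤ D * T := mul_le_mul_of_nonneg_left hs.2.le hD0.le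
      linarith
    have hcube : Zr s ^ 3 ≤ (2 * G + 2) ^ 3 :=
      pow_le_pow_left₀ (hZr0 s) (by linarith) 3
    calc Zr' s ≤ A * Zr s ^ 3 + B := hgen s hs.1
      _ ≤ A * (2 * G + 2) ^ 3 + B := by gcongr
      _ < D := by rw [hD]; linarith
  have hle := image_le_of_deriv_right_lt_deriv_boundary hcont hderiv h0 hBl hbound ht
  -- conclusion
  have hZt : Zr t ≤ 2 * G + 1 := by
    have : D * t ≤ D * T := mul_le_mul_of_nonneg_left ht.2 hD0.le
    linarith
  rw [hZr_of t]
  exact ENNReal.ofReal_le_ofReal hZt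

/-! ## The trajectory-UI statement with a level-dependent window -/

/-- **TUI with the window after the level is a theorem (`N`-uniform).** The registered signature of the
hard stub S1 `stub_trajectoryUI` of line `enstrophy-ui-transfer` with the window quantifier `∃ T` moved AFTER
the data-enstrophy level `∀ G`: for every smooth divergence-free mean-zero force, `ν > 0`, radius `R` and
level `G < ∞` there are a window `T > 0` and (for every tolerance) a finite threshold `M = 2G + 1` such that
for EVERY order `N` and every mean-zero Galerkin mode `a` of order `N` in the `L²`-ball with `‖∇a‖² ≤ G`,
`∫₀ᵀ Z(S^N_t a) 1{Z > M} dt ≤ ε` — indeed the integrand vanishes (`galerkin_enstrophy_local_bound`).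
The conjecture-grade content of S1 is therefore exactly the uniformity of `T` in `G`. [folklore] -/
theorem trajectoryUI_levelDependentWindow :
    ∀ f : UnitAddTorus (Fin 3) → EuclideanSpace ℝ (Fin 3),
      Torus.IsSmooth f → Torus.IsDivFree f → Torus.HasZeroMean f →
      ∀ ν : ℝ, 0 < ν → ∀ R : ℝ, ∀ G : ℝ≥0∞, G ≠ ⊤ → ∃ T : ℝ, 0 < T ∧
        ∀ ε : ℝ≥0∞, 0 < ε → ∃ M : ℝ≥0∞, M ≠ ⊤ ∧
          ∀ (N : ℕ) (a : UnitAddTorus (Fin 3) → EuclideanSpace ℝ (Fin 3)),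
            IsGalerkinMode N a → Torus.HasZeroMean a → ∫ x, ‖a x‖ ^ 2 ≤ R ^ 2 →
            Torus.eGradNormSq a ≤ G →
            ∫⁻ t in Set.Ioo 0 T, (Set.Ioi M).indicator id
                (Torus.eGradNormSq (Torus.galerkinFlow ν f N t a)) ≤ ε := by
  intro f hf _ hf0 ν hν _ G hG
  obtain ⟨T, hT, h⟩ := galerkin_enstrophy_local_bound hν hf hf0 (G := G.toReal) ENNReal.toReal_nonneg
  refine ⟨T, hT, fun ε _ => ⟨ENNReal.ofReal (2 * G.toReal + 1), ENNReal.ofReal_ne_top, ?_⟩⟩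
  intro N a ha ha0 _ hZa
  have hZa' : eGradNormSq a ≤ ENNReal.ofReal G.toReal := by rwa [ENNReal.ofReal_toReal hG]
  have hzero : ∫⁻ t in Set.Ioo 0 T, (Set.Ioi (ENNReal.ofReal (2 * G.toReal + 1))).indicator id
      (Torus.eGradNormSq (Torus.galerkinFlow ν f N t a)) = 0 := by
    refine setLIntegral_eq_zero measurableSet_Ioo fun t ht => ?_
    have hle := h N a ha ha0 hZa' t ⟨ht.1.le, ht.2.le⟩
    exact indicator_of_notMem (fun hgt : _ < _ => absurd hle (not_le.2 hgt)) id
  rw [hzero]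
  exact bot_le

/-! ## Registered tools stub -/

/-- **Registered tools stub `stub_trajectoryUILocalWindow` of stmt-AnomalousDissipation-14284** (line
`enstrophy-ui-transfer`; `ledger workitem stub-add … --name stub_trajectoryUILocalWindow`): the conjunction
of (i) the `N`-uniform local enstrophy bound for the Galerkin systems and (ii) the trajectory-UI statement
with a level-dependent window. [folklore] -/
theorem stub_trajectoryUILocalWindow :
    (∀ (ν : ℝ), 0 < ν → ∀ (f : UnitAddTorus (Fin 3) → EuclideanSpace ℝ (Fin 3)),
      Literature.Analysis.FunctionSpaces.Torus.IsSmooth f →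
      Literature.Analysis.FunctionSpaces.Torus.HasZeroMean f →
      ∀ (G : ℝ), 0 ≤ G → ∃ T : ℝ, 0 < T ∧
        ∀ (N : ℕ) (a : UnitAddTorus (Fin 3) → EuclideanSpace ℝ (Fin 3)),
          Literature.Analysis.FluidPDE.IsGalerkinMode N a →
          Literature.Analysis.FunctionSpaces.Torus.HasZeroMean a →
          Literature.Analysis.FunctionSpaces.Torus.eGradNormSq a ≤ ENNReal.ofReal G →
          ∀ t ∈ Set.Icc (0 : ℝ) T,
            Literature.Analysis.FunctionSpaces.Torus.eGradNormSq
                (Literature.Analysis.FluidPDE.Torus.galerkinFlow ν f N t a) ≤ ENNReal.ofReal (2 * G + 1)) ∧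
    (∀ f : UnitAddTorus (Fin 3) → EuclideanSpace ℝ (Fin 3),
      Literature.Analysis.FunctionSpaces.Torus.IsSmooth f →
      Literature.Analysis.FunctionSpaces.Torus.IsDivFree f →
      Literature.Analysis.FunctionSpaces.Torus.HasZeroMean f →
      ∀ ν : ℝ, 0 < ν → ∀ R : ℝ, ∀ G : ENNReal, G ≠ ⊤ → ∃ T : ℝ, 0 < T ∧
        ∀ ε : ENNReal, 0 < ε → ∃ M : ENNReal, M ≠ ⊤ ∧
          ∀ (N : ℕ) (a : UnitAddTorus (Fin 3) → EuclideanSpace ℝ (Fin 3)),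
            Literature.Analysis.FluidPDE.IsGalerkinMode N a →
            Literature.Analysis.FunctionSpaces.Torus.HasZeroMean a → ∫ x, ‖a x‖ ^ 2 ≤ R ^ 2 →
            Literature.Analysis.FunctionSpaces.Torus.eGradNormSq a ≤ G →
            ∫⁻ t in Set.Ioo 0 T, (Set.Ioi M).indicator id
                (Literature.Analysis.FunctionSpaces.Torus.eGradNormSq
                  (Literature.Analysis.FluidPDE.Torus.galerkinFlow ν f N t a)) ≤ ε) :=
  ⟨fun _ hν _ hf hf0 _ hG => galerkin_enstrophy_local_bound hν hf hf0 hG, trajectoryUI_levelDependentWindow⟩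

end Summit.AnomalousDissipation.AnomalousDissipation.Theorems.MomentParityResolvedDissipation.TrajectoryUILocalWindow

end
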